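import Mathlib
import HarnessLib
import HarnessLib.Audit
import Summits.Parity.Statement
import HarnessLib.Audit.Status.Attr

/-!
Route: HurwitzTauber

DORMANT since 2026-08-24T07:47:30Z (reconciler: no traction for 6.6 d (last activity item-evidence-added at 2026-08-17T16:51:05Z); parked, not closed — `ledger route dormant route-Parity-HurwitzTauber --off` to reactivate) — unstaffed, not closed; items shared with open routes are served there. `ledger route dormant <id> --off` reactivates.

# Route HurwitzTauber — Bateman–Horn in the Dirichlet mean — exact Hurwitz frame, log-averaged
Möbius tail, and Schmidt's slow decrease across scales as the named Tauberian price

RESCUED LINE (lens rescuer, cycle 2): two corpses, one dodge. Golomb's Λ-method (Golomb1970,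
HindryRivoal2005Golomb eq. (14)–(17),
Pontes2012GolombBatemanHorn Thm 7.3) dies at the termwise limit under Σ_d; route LambertRoots dodged
by NOT interchanging (cut the d-sum,
Abel–Poisson kernel, Karamata free, cruxes of Cesàro strength). The GHL corpse TauberianTwins
(retired not-a-thesis: its assembly stopped
at PairsHL) typed (L) log-averaged Hardy–Littlewood + (R) a Tauberian scale condition, for pairs
only. Here, for EVERY Bateman–Horn
system f = (f₁,…,f_k): pass to the DIRICHLET mean D_f(σ) = Σ_n ∏Λ(fᵢ(n)) n^(−σ) and DO interchange —
per divisor tuple d (L = lcm d)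
the class sums are Hurwitz zeta values, and D_f(σ) = (−1)^k [T(σ) + S(σ)/(σ−1) + Rm(σ)] EXACTLY
(support PolarPart): T = first terms
(tuples with lcm ≥ n: the tail), S = the complete log-weighted singular series with Abel weight
L^(−σ) (absolutely convergent for σ > 1,
NO level cut; (−1)^k S(σ) → C(f), support SingularSeriesAbel), Rm = the Hurwitz remainder Σ_d ∏μ log
· L^(−σ) Σ_ν Φ_σ(ν/L) with the
mean-zero kernel Φ_σ(a) = ζ(σ,1+a) − 1/(σ−1) (∫₀¹Φ_σ = 0 exactly). It suffices to show X =
LogMobiusTail ∧ RootHurwitzLaw ∧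
SlowDecrease: (σ−1)T(σ) → 0 (rank 2, the parity core, LOG-averaged), (σ−1)Rm(σ) → 0 (rank 4,
parity-free μ-twisted root law), and
Schmidt's one-sided slow decrease of the Λ-density F(N) = N⁻¹Σ_(n≤N)∏Λ(fᵢ(n)) on multiplicative
scales N → N^(1+δ) (rank 3). Then
(σ−1)D_f(σ) → C(f); Hardy–Littlewood/Karamata (support KaramataLog, coefficients ≥ 0) gives the
LOGARITHMIC mean Σ_(n≤x)∏Λ(fᵢ(n))/n ~
C(f) log x; Schmidt's Tauberian theorem for the logarithmic method (support SchmidtScales, with the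
Brun–Selberg bound LambdaUpperBound)
upgrades it to Σ_(n≤x)∏Λ(fᵢ(n)) ~ C(f)x, and LambdaToCount (= PolynomialMobius stmt-Parity-0874
verbatim) gives BatemanHornAsymptotic f.
Because the deciding theorem may assume CRUX items only (ruling 2026-08-16), the theorem-grade chain
is ONE frame crux FrameToBH (rank 5: for every system, the three cruxes at that system ⇒
BatemanHornAsymptotic f), whose birth skeleton has the six supports as stubs and the
Karamata–Schmidt chain as its KERNEL-CHECKED composition (bc/FrameToBH_birth.lean, sorries = stubs);
`closes : LogMobiusTail → RootHurwitzLaw → SlowDecrease → FrameToBH → BatemanHorn` is proved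
(glue.lean). No idea card is realised (lens corpus route).
Lean: `LogMobiusTail ∧ RootHurwitzLaw ∧ SlowDecrease ∧ FrameToBH`

## Assembly
Crux-only deciding theorem, PROVED in glue.lean: `closes (hTail : LogMobiusTail) (hRoot :
RootHurwitzLaw) (hSlow : SlowDecrease)
(hFrame : FrameToBH) : BatemanHorn := fun k f hf => hFrame k f hf (hTail k f hf) (hRoot k f hf)
(hSlow k f hf)` — every crux is a binder
and occurs in the proof term. The mathematics of the frame (Abel mean from the exact Hurwitz
identity; Karamata; Schmidt; IsEquivalent;
LambdaToCount) is the kernel-checked composition `FrameToBH_of : SingularSeriesAbel → PolarPart →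
LambdaUpperBound → KaramataLog →
SchmidtScales → LambdaToCount → FrameToBH` (bc/FrameToBH_birth.lean), i.e. FrameToBH closes as soon
as its six supports land.

Rationale: WHY THIS LINE. The cut is along the AVERAGING axis, not the divisor-range axis of every live
BatemanHorn frame: Bateman–Horn ⟺ (log-density of prime
values = C(f)) ∧ (a Tauberian regularity across scales), and the catalogued barrier
Literature.Barriers.Parity.LogarithmicAveraging
(Hall1996SetsOfMultiples (0.15); TaoTeravainen2019AlmostAllScales §1) says precisely that the second
conjunct cannot be dispensed
with by soft means — so it is NAMED as a crux (SlowDecrease, Schmidt1925's condition in the variable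
log N) and the glue is the Tauberian
theorem (Korevaar2004 Ch. I–II; HardyLittlewood1914). What the Dirichlet mean buys that the Cesàro
frame (PolynomialMobius) and the
Abel–Poisson frame (LambertRoots) do not: the complete singular series is unconditional with no
level x^(1−η) (Golomb's phenomenon in
Mellin form; Conrad2003HardyLittlewoodConstants), the sub-level sawtooth window of the Cesàro frame
is replaced by the smooth mean-zero
Hurwitz kernel (RootHurwitzLaw, a MuRootWeyl-type statement:
DukeFriedlanderIwaniec1995/Toth2000-grade for quadratic members, Hooley1964
qualitative for higher degree), and the parity core is asked only LOG-averaged — the averaging under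
which every deep correlation
theorem of the last decade is proved (TaoFMP2016; Tao's own caveat p. 4 that multiplicativity in n
is used is recorded as the why-might-fail).
Imported area: classical Tauberian theory (Hardy–Littlewood–Karamata, Schmidt) and Hurwitz-zeta
bookkeeping; nothing probabilistic or
spectral. Negatives index (3 GHL items) untouched.

RANKED CRUXES. #2 LogMobiusTail (crux) — the LOG-AVERAGED Möbius tail: for every BH system, with
T(σ,n) = n^(−σ) Σ over divisor tuples d (dᵢ ∣ fᵢ(n), all fᵢ(n) > 0) with lcm(d) ≥ n of ∏ μ(dᵢ) log
dᵢ, the series Σ_n T(σ,n) is summable for σ > 1 and (σ−1)·Σ_n T(σ,n) → 0 as σ → 1⁺ (equivalently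
Σ_(n≤x) T_≥(n)/n = o(log x): the first-term piece of the Hurwitz decomposition). [difficulty:
open-problem] (why it might fail: It is the parity core (implies Hypothesis H qualitatively via the
route); log-averaging technology (entropy decrement) uses multiplicativity in n (TaoFMP2016 p.4),
absent for μ along polynomial progressions; open even for n²+1.) [TaoFMP2016,
TaoTeravainen2019AlmostAllScales, Golomb1970, HindryRivoal2005Golomb, stmt-Parity-0870]
#3 SlowDecrease (crux) — Schmidt's one-sided Tauberian condition for the logarithmic method: for
every BH system and ε > 0 there are δ > 0, N₀ with F(N') ≥ F(N) − ε whenever N₀ ≤ N ≤ N' ≤ N^(1+δ),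
F(N) = N⁻¹ Σ_(n≤N) ∏ᵢ Λ(fᵢ(n)) — the prime-value density cannot drop abruptly between scale N and
N^(1+δ). [difficulty: open-problem] (why it might fail: Implied by BH but no scale-comparison
principle for prime values of a fixed polynomial is known; a Selberg ghost with drifting parity
parameter θ(N) violates it, so it is parity-sensitive (not a Type-I consequence) though value-free.)
[Schmidt1925, Korevaar2004, Literature.Barriers.Parity.LogarithmicAveraging,
TaoTeravainen2019AlmostAllScales]
#4 RootHurwitzLaw (crux) — the Hurwitz remainder is negligible: for every BH system, with δ_σ(n,d) =
n^(−σ) − (average of u^(−σ) over [a, a+L]), a = L⌊(n−1)/L⌋, L = lcm(d), the series Rm(σ) = Σ_n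
Σ_(tuples d ∣ f(n), L < n) ∏μ(dᵢ) log dᵢ · δ_σ(n,d) is summable for σ > 1 and (σ−1)Rm(σ) → 0; per
class this is Σ_d ∏μ log · L^(−σ) Σ_(ν∈R(d)) Φ_σ(ν/L) with the mean-zero kernel Φ_σ(a) = ζ(σ,1+a) −
1/(σ−1) (up to a finite correction): μ-twisted equidistribution of root classes ν/L with Abel
weights, one logarithm of saving (Erdős–Turán at frequencies ≤ (log)²). [difficulty: XL] (why it
might fail: Needs a one-log saving in μ-twisted root Weyl sums over all moduli: DFI/Tóth-grade for
quadratic members, but for a member of degree ≥ 3 only Hooley's qualitative equidistribution is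
known (the same wall as LambertRoots.MuRootWeyl).) [Hooley1964, DukeFriedlanderIwaniec1995,
Toth2000, stmt-Parity-16279]
#5 FrameToBH (crux) — the Dirichlet frame decides Bateman–Horn system by system: for every BH
system, (LogMobiusTail at f) → (RootHurwitzLaw at f) → (SlowDecrease at f) → BatemanHornAsymptotic
f. Theorem-grade (kind crux only because `closes` may assume crux items only): Abel mean (σ−1)D_f(σ)
→ C(f) from the exact identity of PolarPart + SingularSeriesAbel + the two vanishing limits;
Hardy–Littlewood/Karamata (KaramataLog) ⇒ logarithmic mean; Schmidt (SchmidtScales) with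
LambdaUpperBound and slow decrease ⇒ Cesàro mean; LambdaToCount ⇒ the count. The composition from
the six supports is kernel-checked (bc/FrameToBH_birth.lean, `FrameToBH_of`, 54-line proof, sorries
only in the six support stubs). [deps: LogMobiusTail, RootHurwitzLaw, SlowDecrease] [difficulty: XL]
(why it might fail: Theorem-grade; fails only if SingularSeriesAbel's Abel limit is not exactly C(f)
(normalisation of the multivariable Euler product) — then restate with the computed constant and
LambdaToCount's C.) [HardyLittlewood1914, Schmidt1925, Korevaar2004,
Conrad2003HardyLittlewoodConstants, stmt-Parity-0874]
#9 SingularSeriesAbel (support) — Abelian evaluation of the COMPLETE log-weighted singular series: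
S(σ) = Σ_d ∏μ(dᵢ) log dᵢ · |R(d)| · lcm(d)^(−σ) (R(d) = root classes mod lcm) is absolutely summable
for σ > 1 and (−1)^k S(σ) → C(f) with HasBatemanHornConst f C, C > 0 (multivariable Euler product
∏_p(1 − ω_f(p)p^(−s)) times ζ(s)^k, Abel's theorem for Dirichlet series from the prime ideal
theorem; follows from LambertRoots.SingularSeriesLcm by Abel summation in lcm). [difficulty: L]
[Conrad2003HardyLittlewoodConstants, BatemanHornMathComp1962, stmt-Parity-16280]
#9 PolarPart (support) — the exact three-piece decomposition and the polar class sum: for σ > 1 all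
pieces are summable, Σ_n ∏Λ(fᵢ(n)) n^(−σ) = (−1)^k (Σ_n T + Σ_n P + Σ_n Rm) termwise (Λ = −(μ·log)∗1
per coordinate and n^(−σ) = [n ≤ L]n^(−σ) + [L < n](average + δ_σ)), and (σ−1)Σ_n P(σ,n) − S(σ) → 0
(per residue class the averages telescope to L^(−σ)/(σ−1); the finitely many n with some fᵢ(n) ≤ 0
cost O(σ−1)). [difficulty: M] [Korevaar2004, MontgomeryVaughan2007]
#9 LambdaUpperBound (support) — Brun–Selberg upper bound: Σ_(n≤x) ∏ᵢ Λ(fᵢ(n)) ≤ B·x for all x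
(Bateman–Horn (2) / Bateman–Stemmler with log weights and prime powers). [difficulty: M]
[BatemanHornMathComp1962, Tenenbaum2015]
#9 KaramataLog (support) — Hardy–Littlewood (1914) / Karamata Tauberian theorem for Dirichlet series
with non-negative coefficients, logarithmic conclusion: b ≥ 0, Σ b(n) n^(−σ) summable for σ > 1 and
(σ−1)Σ b(n)n^(−σ) → C as σ → 1⁺ imply Σ_(n≤x) b(n)/n ~ C log x (MontgomeryVaughan2007 Thm 5.11 with
β = 1). [difficulty: L] [HardyLittlewood1914, Korevaar2004, MontgomeryVaughan2007]
#9 SchmidtScales (support) — Schmidt-type Tauberian theorem for the logarithmic mean: b ≥ 0 with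
Σ_(n≤x) b(n) ≤ Bx, logarithmic mean value C, and one-sided slow decrease of x⁻¹Σ_(n≤x) b(n) on
multiplicative scales x → x^(1+δ) imply the mean value C (Cesàro mean in u = log x plus slow
decrease on [u,(1+δ)u]; elementary). [difficulty: M] [Schmidt1925, Korevaar2004,
Hall1996SetsOfMultiples]
#9 LambdaToCount (support) — from Λ-weights to the count (verbatim PolynomialMobius
stmt-Parity-0874): Σ_(n≤x)∏Λ(fᵢ(n)) ~ C·x with HasBatemanHornConst f C gives BatemanHornAsymptotic
f. [difficulty: M] [stmt-Parity-0874, BatemanHornMathComp1962]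

TWO-LAYER PLAN. Foreseen glued splits (birth skeletons kernel-checked in bc/, sorries = stubs):
FrameToBH ⇐ the six supports (composition proved); LogMobiusTail ⇐ NearStub (n ≤ lcm ≤ n²) →
DeepStub
(lcm > n²) → LogMobiusTail (range cut); RootHurwitzLaw ⇐ BelowScale (lcm ≤ e^(1/(σ−1))) → AboveScale
→ RootHurwitzLaw (Abel-scale
cut); SlowDecrease ⇐ TransferStub (Λ-density ↔ normalised count density, theorem-grade) →
CountSlowDecrease → SlowDecrease (ε/3).

KILL CRITERIA. A refutation of SlowDecrease or LogMobiusTail refutes Bateman–Horn itself (both are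
consequences of BH modulo the supports / RootHurwitzLaw)
— close `refuted:<Decl>` and hand the witness to the summit. RootHurwitzLaw refuted for one system
(a biased root configuration surviving the
μ-twist) ⇒ pivot: restate with the bias as an explicit secondary term in PolarPart.
SingularSeriesAbel with a normalisation other than C(f)
⇒ misstated support, repair in place. PolyMobiusTail (stmt-Parity-0870) proved elsewhere moots the
route (it implies every item here).

NOT DECOMPOSED YET. The Erdős–Turán/Vaaler bookkeeping turning RootHurwitzLaw into MuRootWeyl-type
exponential sums (layer-2 child of RootHurwitzLaw); the
near/deep and count/Λ splits above; any use of almost-all-scales technology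
(TaoTeravainen2019AlmostAllScales Remark 1.11: a good scale in
every [X, X^(1+ε)] would replace SlowDecrease by a two-sided oscillation bound — a possible
restatement, not filed now); KaramataLog and
SchmidtScales are general-sequence theorems left whole for provers.

CHEAPEST FALSIFIER. (i) In Lean, now: the k = 0 instances (PolarPart reduces to ζ(σ) − 1 − 1/(σ−1) →
γ − 1; SlowDecrease k = 0 PROVED in bc/Special.lean);
(ii) numerics (kit, one job): for f = X²+1 and σ = 1 + 1/log X, X = 10⁶…10⁸, tabulate (σ−1)T(σ),
(σ−1)Rm(σ) and (−1)^k S(σ) against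
C(f) = 1.3728134628…: a visible non-decay of (σ−1)T or a limit of S other than C(f) kills
LogMobiusTail's framing or SingularSeriesAbel's
normalisation; (iii) literature: is Schmidt's condition for π_f known to follow from any sieve
inequality (Brun–Titchmarsh along f)? — it
is not (the bound controls increments over x → (1+η)x only, bc/SlowDecrease_birth.lean TransferStub
scale), recorded.

NUMBERS. C(X²+1) = 1.3728134628 (Conjecture E constant); twins C = 2C₂ = 1.3203236316. Hall's set:
log density 1/2, natural densities 1/3, 2/3
(Literature.Barriers.Parity.LogarithmicAveraging, PROVED). Root Weyl sums for quadratics: power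
saving (DukeFriedlanderIwaniec1995 prime moduli,
Toth2000 all moduli); degree ≥ 3: o(1) only (Hooley1964). Items at open: 11 (4 cruxes incl. the
theorem-grade frame, 6 supports, 1 assembly).

DEFINITION REQUESTS. None: Hurwitz pieces are written with explicit elementary averages ((a+L)^(1−σ)
− a^(1−σ))/((1−σ)L), no special functions; all
constants exist (Literature.NumberTheory.Sieve.IsBatemanHornSystem, HasBatemanHornConst,
polyPrimeCount, BatemanHornAsymptotic,
ArithmeticFunction.vonMangoldt/moebius, Finset.lcm, Fintype.piFinset).

Novelty: Searches (2026-08-17): `lit search --hybrid "Dirichlet series of von Mangoldt function along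
polynomial values Hurwitz zeta Tauberian theorem prime values"` (10 book hits, none on Λ∘f); `lit
search --hybrid "logarithmic density prime values of polynomials slowly decreasing Tauberian
Schmidt"` (8, MontgomeryVaughan2007 §5.2/§8.3, Hall1996); `lit search --hybrid "prime values of
polynomials n^2+1 conditional proof hypothesis bilinear forms Kloosterman"` (12; arXiv:math/9811185,
arXiv:1507.05080); `lit galaxy search "Bateman-Horn conjecture Tauberian" --star all` (0); `lit
galaxy search "Bateman-Horn conjecture" --star all` (22, textbooks + arXiv:1507.05080); corpus:
graveyard.jsonl (35), retired_statements.jsonl (35), failed_programmes_lit.json, tp/gb SURVEY §(B)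
B5 (Korevaar2005 two-way Wiener–Ikehara; Arenstorf math/0405509 withdrawn) and §(C) C14; ledger
negatives (3, GHL).
Nearest prior art found: Golomb1970 / HindryRivoal2005Golomb / Pontes2012GolombBatemanHorn
(power-series Λ-method for BH, termwise limit illegitimate) and route LambertRoots (its rescue: cut
the d-sum, Karamata free); Korevaar2005 (twins via Dirichlet series and Wiener–Ikehara, an
equivalence); corpse TauberianTwins (GHL: (L) log-averaged HL + (R) scale rigidity, pairs only,
retired not-a-thesis).
Delta: first BatemanHorn-side (all systems, all degrees) frame in the DIRICHLET mean, where the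
interchange Golomb could not justify becomes an exact Hurwitz identity with unconditional singular
series and a LOG  [refs: math/9811185, 1507.05080, MontgomeryVaughan2007, Korevaar2005, Golomb1970]

Barriers (technique_class: dirichlet-mean hurwitz-decomposition tauberian-slow-decrease): - technique_class: dirichlet-mean hurwitz-decomposition tauberian-slow-decrease
- Literature.Barriers.Parity.LogarithmicAveraging: escaped BY NAME — the entry proves
LogToMeanTransfer fails on non-negative bounded-density sequences (Hall's set) and prescribes "a
genuine second input ((R) scale rigidity or (I) Ikehara)"; SlowDecrease IS that input (one-sided
Schmidt form) and the glue SchmidtScales is a theorem about sequences satisfying it, not a transfer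
on a class; the almost-all-scales evasion (TT Remark 1.11) is recorded under Not decomposed yet.
- Literature.Barriers.Parity.SelbergParityBarrier: not evaded and not engaged illegitimately — no
item derives a prime count from Type-I data; the parity content is isolated and NAMED in
LogMobiusTail (rank 2, flagged parity core); SlowDecrease is ghost-violable (a drifting parity
parameter) hence also not a Type-I consequence; RootHurwitzLaw and all supports are parity-free.
- Literature.Barriers.Parity.FordMaynardLowLevel: not engaged — no Type-I/II decomposition of the
thin value set is attempted; the frame is an identity plus Tauberian theorems.
- Literature.Barriers.Parity.CircleMethodBinaryBarrier: not engaged — no minor arcs; the only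
exponential sums are root Weyl sums in RootHurwitzLaw (modulus side, parity-free).
- Literature.Barriers.Parity.UniformBatemanHornBarrier: not engaged — every item is for a FIXED
system as x → ∞ (no uniformity in the height).
- Literature.Barriers.Parity.FriedlanderGranvilleUniformityBarrier:

History (route lifecycle, newest last):
- 2026-08-24T07:47:30Z · DORMANT — reconciler: no traction for 6.6 d (last activity item-evidence-added at 2026-08-17T16:51:05Z); parked, not closed — `ledger route dormant route-Parity-HurwitzTa (operator:999:1884473)

sub-problem: BatemanHorn · status: dormant · opened planner-plan-lens3-Parity-rescuer-g2-0 2026-08-17T03:14:19Z · rev 2 · ledger route-Parity-HurwitzTauber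
GENERATED by the gate from the ledger (D-0016/17). Provers cite these decls: `theorem foo : Summit.Parity.BatemanHorn.Theses.HurwitzTauber.<Decl> := …` in Summits/Parity/BatemanHorn/Theorems/<Name>.lean.
-/

namespace Summit.Parity.BatemanHorn.Theses.HurwitzTauber

open scoped BigOperators Topology Manifold Classical MeasureTheory ProbabilityTheory Matrix InnerProductSpace ComplexConjugate ContinuousMap
open Filter Set Function TopologicalSpace MeasureTheory

attribute [summit_statement] _root_.BatemanHorn

/-- item stmt-Parity-19022 · crux · rank 2 · open · by planner
why it might fail: It is the parity core (implies Hypothesis H qualitatively via the route); log-averaging technology (entropy decrement) uses multiplicativity in n (TaoFMP2016 p.4), absent for μ along polynomial progressions; open even for n²+1.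
sources: TaoFMP2016, TaoTeravainen2019AlmostAllScales, Golomb1970, HindryRivoal2005Golomb, stmt-Parity-0870
[crux] the LOG-AVERAGED Möbius tail: for every BH system, with T(σ,n) = n^(−σ) Σ over divisor tuples
d (dᵢ ∣ fᵢ(n), all fᵢ(n) > 0) with lcm(d) ≥ n of ∏ μ(dᵢ) log dᵢ, the series Σ_n T(σ,n) is summable
for σ > 1 and (σ−1)·Σ_n T(σ,n) → 0 as σ → 1⁺ (equivalently Σ_(n≤x) T_≥(n)/n = o(log x): the
first-term piece of the Hurwitz decomposition). [difficulty: open-problem] -/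
@[route_item "route-Parity-HurwitzTauber", crux]
def LogMobiusTail : Prop :=
  ∀ (k : ℕ) (f : Fin k → Polynomial ℤ), Literature.NumberTheory.Sieve.IsBatemanHornSystem f → let T : ℝ → ℕ → ℝ := fun σ n => (n : ℝ) ^ (-σ) * ∑ d ∈ (Fintype.piFinset (fun i => (((f i).eval (n : ℤ)).toNat).divisors)).filter (fun d => n ≤ Finset.univ.lcm d), ∏ i, ((ArithmeticFunction.moebius (d i) : ℝ) * Real.log (d i)); (∀ σ : ℝ, 1 < σ → Summable (T σ)) ∧ Filter.Tendsto (fun σ : ℝ => (σ - 1) * ∑' n : ℕ, T σ n) (nhdsWithin 1 (Set.Ioi 1)) (nhds 0)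

/-- item stmt-Parity-19023 · crux · rank 3 · open · by planner
why it might fail: Implied by BH but no scale-comparison principle for prime values of a fixed polynomial is known; a Selberg ghost with drifting parity parameter θ(N) violates it, so it is parity-sensitive (not a Type-I consequence) though value-free.
sources: Schmidt1925, Korevaar2004, Literature.Barriers.Parity.LogarithmicAveraging, TaoTeravainen2019AlmostAllScales
[crux] Schmidt's one-sided Tauberian condition for the logarithmic method: for every BH system and ε
> 0 there are δ > 0, N₀ with F(N') ≥ F(N) − ε whenever N₀ ≤ N ≤ N' ≤ N^(1+δ), F(N) = N⁻¹ Σ_(n≤N) ∏ᵢ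
Λ(fᵢ(n)) — the prime-value density cannot drop abruptly between scale N and N^(1+δ). [difficulty:
open-problem] -/
@[route_item "route-Parity-HurwitzTauber", crux]
def SlowDecrease : Prop :=
  ∀ (k : ℕ) (f : Fin k → Polynomial ℤ), Literature.NumberTheory.Sieve.IsBatemanHornSystem f → ∀ ε : ℝ, 0 < ε → ∃ δ : ℝ, 0 < δ ∧ ∃ N₀ : ℕ, ∀ N N' : ℕ, N₀ ≤ N → N ≤ N' → (N' : ℝ) ≤ (N : ℝ) ^ (1 + δ) → (∑ n ∈ Finset.Icc 1 N, ∏ i, ArithmeticFunction.vonMangoldt (((f i).eval (n : ℤ)).toNat)) / N - ε ≤ (∑ n ∈ Finset.Icc 1 N', ∏ i, ArithmeticFunction.vonMangoldt (((f i).eval (n : ℤ)).toNat)) / N'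

/-- item stmt-Parity-19024 · crux · rank 4 · open · by planner
why it might fail: Needs a one-log saving in μ-twisted root Weyl sums over all moduli: DFI/Tóth-grade for quadratic members, but for a member of degree ≥ 3 only Hooley's qualitative equidistribution is known (the same wall as LambertRoots.MuRootWeyl).
sources: Hooley1964, DukeFriedlanderIwaniec1995, Toth2000, stmt-Parity-16279
[crux] the Hurwitz remainder is negligible: for every BH system, with δ_σ(n,d) = n^(−σ) − (average
of u^(−σ) over [a, a+L]), a = L⌊(n−1)/L⌋, L = lcm(d), the series Rm(σ) = Σ_n Σ_(tuples d ∣ f(n), L <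
n) ∏μ(dᵢ) log dᵢ · δ_σ(n,d) is summable for σ > 1 and (σ−1)Rm(σ) → 0; per class this is Σ_d ∏μ log ·
L^(−σ) Σ_(ν∈R(d)) Φ_σ(ν/L) with the mean-zero kernel Φ_σ(a) = ζ(σ,1+a) − 1/(σ−1) (up to a finite
correction): μ-twisted equidistribution of root classes ν/L with Abel weights, one logarithm of
saving (Erdős–Turán at frequencies ≤ (log)²). [difficulty: XL] -/
@[route_item "route-Parity-HurwitzTauber", crux]
def RootHurwitzLaw : Prop :=
  ∀ (k : ℕ) (f : Fin k → Polynomial ℤ), Literature.NumberTheory.Sieve.IsBatemanHornSystem f → let R : ℝ → ℕ → ℝ := fun σ n => ∑ d ∈ (Fintype.piFinset (fun i => (((f i).eval (n : ℤ)).toNat).divisors)).filter (fun d => Finset.univ.lcm d < n), (∏ i, ((ArithmeticFunction.moebius (d i) : ℝ) * Real.log (d i))) * ((n : ℝ) ^ (-σ) - ((((Finset.univ.lcm d : ℕ) : ℝ) * ((((n - 1) / Finset.univ.lcm d : ℕ) : ℝ) + 1)) ^ (1 - σ) - (((Finset.univ.lcm d : ℕ) : ℝ) * (((n - 1) / Finset.univ.lcm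 d : ℕ) : ℝ)) ^ (1 - σ)) / ((1 - σ) * ((Finset.univ.lcm d : ℕ) : ℝ))); (∀ σ : ℝ, 1 < σ → Summable (R σ)) ∧ Filter.Tendsto (fun σ : ℝ => (σ - 1) * ∑' n : ℕ, R σ n) (nhdsWithin 1 (Set.Ioi 1)) (nhds 0)

/-- item stmt-Parity-19025 · crux · rank 5 · open · by planner
why it might fail: Theorem-grade; fails only if SingularSeriesAbel's Abel limit is not exactly C(f) (normalisation of the multivariable Euler product) — then restate with the computed constant and LambdaToCount's C.
sources: HardyLittlewood1914, Schmidt1925, Korevaar2004, Conrad2003HardyLittlewoodConstants, stmt-Parity-0874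
[crux] the Dirichlet frame decides Bateman–Horn system by system: for every BH system,
(LogMobiusTail at f) → (RootHurwitzLaw at f) → (SlowDecrease at f) → BatemanHornAsymptotic f.
Theorem-grade (kind crux only because `closes` may assume crux items only): Abel mean (σ−1)D_f(σ) →
C(f) from the exact identity of PolarPart + SingularSeriesAbel + the two vanishing limits;
Hardy–Littlewood/Karamata (KaramataLog) ⇒ logarithmic mean; Schmidt (SchmidtScales) with
LambdaUpperBound and slow decrease ⇒ Cesàro mean; LambdaToCount ⇒ the count. The composition from
the six supports is kernel-checked (bc/FrameToBH_birth.lean, `FrameToBH_of`, 54-line proof, sorries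
only in the six support stubs). [deps: LogMobiusTail, RootHurwitzLaw, SlowDecrease] [difficulty: XL] -/
@[route_item "route-Parity-HurwitzTauber", crux]
def FrameToBH : Prop :=
  ∀ (k : ℕ) (f : Fin k → Polynomial ℤ), Literature.NumberTheory.Sieve.IsBatemanHornSystem f → (let T : ℝ → ℕ → ℝ := fun σ n => (n : ℝ) ^ (-σ) * ∑ d ∈ (Fintype.piFinset (fun i => (((f i).eval (n : ℤ)).toNat).divisors)).filter (fun d => n ≤ Finset.univ.lcm d), ∏ i, ((ArithmeticFunction.moebius (d i) : ℝ) * Real.log (d i)); (∀ σ : ℝ, 1 < σ → Summable (T σ)) ∧ Filter.Tendsto (fun σ : ℝ => (σ - 1) * ∑' n : ℕ, T σ n) (nhdsWithin 1 (Set.Ioi 1)) (nhds 0)) → (let R : ℝ → ℕ → ℝ := fun σ n => ∑ d ∈ (Fintype.piFinset (fun i => (((f i).eval (n : ℤ)).toNat).divisors)).filter (fun d => Finset.univ.lcm d < n), (∏ i, ((ArithmeticFunction.moebius (d i) : ℝ) * Real.log (d i))) * ((n : ℝ) ^ (-σ) - ((((Finset.univ.lcm d : ℕ) : ℝ) * ((((n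 - 1) / Finset.univ.lcm d : ℕ) : ℝ) + 1)) ^ (1 - σ) - (((Finset.univ.lcm d : ℕ) : ℝ) * (((n - 1) / Finset.univ.lcm d : ℕ) : ℝ)) ^ (1 - σ)) / ((1 - σ) * ((Finset.univ.lcm d : ℕ) : ℝ))); (∀ σ : ℝ, 1 < σ → Summable (R σ)) ∧ Filter.Tendsto (fun σ : ℝ => (σ - 1) * ∑' n : ℕ, R σ n) (nhdsWithin 1 (Set.Ioi 1)) (nhds 0)) → (∀ ε : ℝ, 0 < ε → ∃ δ : ℝ, 0 < δ ∧ ∃ N₀ : ℕ, ∀ N N' : ℕ, N₀ ≤ N → N ≤ N' → (N' : ℝ) ≤ (N : ℝ) ^ (1 + δ) → (∑ n ∈ Finset.Icc 1 N, ∏ i, ArithmeticFunction.vonMangoldt (((f i).eval (n : ℤ)).toNat)) / N - ε ≤ (∑ n ∈ Finset.Icc 1 N', ∏ i, ArithmeticFunction.vonMangoldt (((f i).eval (n : ℤ)).toNat)) / N') → Literature.NumberTheory.Sieve.BatemanHornAsymptotic f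

/-- item stmt-Parity-16283 · support · rank 9 · open · by planner
sources: stmt-Parity-0874, BatemanHornMathComp1962
[support] shared VERBATIM with PolynomialMobius (stmt-Parity-0874, closed proved by
Summit.Parity.BatemanHorn.LambdaToCount.lambdaToCount_proof): Σ_(n ≤ x) ∏Λ(f_i(n)) ~ C x with
HasBatemanHornConst f C gives BatemanHornAsymptotic f. [difficulty: provable-now] -/
@[route_item "route-Parity-HurwitzTauber"]
def LambdaToCount : Prop :=
  ∀ (k : ℕ) (f : Fin k → Polynomial ℤ), Literature.NumberTheory.Sieve.IsBatemanHornSystem f → ∀ C : ℝ, 0 < C → Literature.NumberTheory.Sieve.HasBatemanHornConst f C → Asymptotics.IsEquivalent Filter.atTop (fun x : ℕ => ∑ n ∈ Finset.Icc 1 x, ∏ i, ArithmeticFunction.vonMangoldt (((f i).eval (n : ℤ)).toNat)) (fun x : ℕ => C * (x : ℝ)) → Literature.NumberTheory.Sieve.BatemanHornAsymptotic f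

/-- item stmt-Parity-19026 · support · rank 9 · open · by planner
sources: Conrad2003HardyLittlewoodConstants, BatemanHornMathComp1962, stmt-Parity-16280
[support] Abelian evaluation of the COMPLETE log-weighted singular series: S(σ) = Σ_d ∏μ(dᵢ) log dᵢ
· |R(d)| · lcm(d)^(−σ) (R(d) = root classes mod lcm) is absolutely summable for σ > 1 and (−1)^k
S(σ) → C(f) with HasBatemanHornConst f C, C > 0 (multivariable Euler product ∏_p(1 − ω_f(p)p^(−s))
times ζ(s)^k, Abel's theorem for Dirichlet series from the prime ideal theorem; follows from
LambertRoots.SingularSeriesLcm by Abel summation in lcm). [difficulty: L] -/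
@[route_item "route-Parity-HurwitzTauber"]
def SingularSeriesAbel : Prop :=
  ∀ (k : ℕ) (f : Fin k → Polynomial ℤ), Literature.NumberTheory.Sieve.IsBatemanHornSystem f → let S : ℝ → (Fin k → ℕ) → ℝ := fun σ d => (∏ i, ((ArithmeticFunction.moebius (d i) : ℝ) * Real.log (d i))) * ((((Finset.range (Finset.univ.lcm d)).filter (fun ν : ℕ => ∀ i, ((d i : ℕ) : ℤ) ∣ (f i).eval (ν : ℤ))).card : ℕ) : ℝ) * ((Finset.univ.lcm d : ℕ) : ℝ) ^ (-σ); ∃ C : ℝ, 0 < C ∧ Literature.NumberTheory.Sieve.HasBatemanHornConst f C ∧ (∀ σ : ℝ, 1 < σ → Summable (S σ)) ∧ Filter.Tendsto (fun σ : ℝ => (-1 : ℝ) ^ k * ∑' d : Fin k → ℕ, S σ d) (nhdsWithin 1 (Set.Ioi 1)) (nhds C)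

/-- item stmt-Parity-19027 · support · rank 9 · open · by planner
sources: Korevaar2004, MontgomeryVaughan2007
[support] the exact three-piece decomposition and the polar class sum: for σ > 1 all pieces are
summable, Σ_n ∏Λ(fᵢ(n)) n^(−σ) = (−1)^k (Σ_n T + Σ_n P + Σ_n Rm) termwise (Λ = −(μ·log)∗1 per
coordinate and n^(−σ) = [n ≤ L]n^(−σ) + [L < n](average + δ_σ)), and (σ−1)Σ_n P(σ,n) − S(σ) → 0 (per
residue class the averages telescope to L^(−σ)/(σ−1); the finitely many n with some fᵢ(n) ≤ 0 cost
O(σ−1)). [difficulty: M] -/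
@[route_item "route-Parity-HurwitzTauber"]
def PolarPart : Prop :=
  ∀ (k : ℕ) (f : Fin k → Polynomial ℤ), Literature.NumberTheory.Sieve.IsBatemanHornSystem f → let a : ℕ → ℝ := fun n => ∏ i, ArithmeticFunction.vonMangoldt (((f i).eval (n : ℤ)).toNat); let w : (Fin k → ℕ) → ℝ := fun d => ∏ i, ((ArithmeticFunction.moebius (d i) : ℝ) * Real.log (d i)); let Dv : ℕ → Finset (Fin k → ℕ) := fun n => Fintype.piFinset (fun i => (((f i).eval (n : ℤ)).toNat).divisors); let T : ℝ → ℕ → ℝ := fun σ n => (n : ℝ) ^ (-σ) * ∑ d ∈ (Dv n).filter (fun d => n ≤ Finset.univ.lcm d), w d; let P : ℝ → ℕ → ℝ := fun σ n => ∑ d ∈ (Dv n).filter (fun d => Finset.univ.lcm d < n), w d * ((((Finset.univ.lcm d : ℕ) : ℝ) * ((((n - 1) / Finset.univ.lcm d : ℕ) : ℝ) + 1)) ^ (1 - σ) - (((Finset.univ.lcm d : ℕ) : ℝ) * (((n - 1) / Finset.univ.lcm d : ℕ) : ℝ)) ^ (1 - σ)) / ((1 - σ) * ((Finset.univ.lcm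 d : ℕ) : ℝ)); let R : ℝ → ℕ → ℝ := fun σ n => ∑ d ∈ (Dv n).filter (fun d => Finset.univ.lcm d < n), w d * ((n : ℝ) ^ (-σ) - ((((Finset.univ.lcm d : ℕ) : ℝ) * ((((n - 1) / Finset.univ.lcm d : ℕ) : ℝ) + 1)) ^ (1 - σ) - (((Finset.univ.lcm d : ℕ) : ℝ) * (((n - 1) / Finset.univ.lcm d : ℕ) : ℝ)) ^ (1 - σ)) / ((1 - σ) * ((Finset.univ.lcm d : ℕ) : ℝ))); let S : ℝ → (Fin k → ℕ) → ℝ := fun σ d => w d * ((((Finset.range (Finset.univ.lcm d)).filter (fun ν : ℕ => ∀ i, ((d i : ℕ) : ℤ) ∣ (f i).eval (ν : ℤ))).card : ℕ) : ℝ) * ((Finset.univ.lcm d : ℕ) : ℝ) ^ (-σ); (∀ σ : ℝ, 1 < σ → Summable (fun n : ℕ => a n * (n : ℝ) ^ (-σ)) ∧ Summable (T σ) ∧ Summable (P σ) ∧ Summable (R σ) ∧ Summable (S σ) ∧ (∑' n : ℕ, a n * (n : ℝ) ^ (-σ)) = (-1 : ℝ) ^ k * ((∑' n : ℕ, T σ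 n) + (∑' n : ℕ, P σ n) + (∑' n : ℕ, R σ n))) ∧ Filter.Tendsto (fun σ : ℝ => (σ - 1) * (∑' n : ℕ, P σ n) - ∑' d : Fin k → ℕ, S σ d) (nhdsWithin 1 (Set.Ioi 1)) (nhds 0)

/-- item stmt-Parity-19028 · support · rank 9 · open · by planner
sources: BatemanHornMathComp1962, Tenenbaum2015
[support] Brun–Selberg upper bound: Σ_(n≤x) ∏ᵢ Λ(fᵢ(n)) ≤ B·x for all x (Bateman–Horn (2) /
Bateman–Stemmler with log weights and prime powers). [difficulty: M] -/
@[route_item "route-Parity-HurwitzTauber"]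
def LambdaUpperBound : Prop :=
  ∀ (k : ℕ) (f : Fin k → Polynomial ℤ), Literature.NumberTheory.Sieve.IsBatemanHornSystem f → ∃ B : ℝ, ∀ x : ℕ, (∑ n ∈ Finset.Icc 1 x, ∏ i, ArithmeticFunction.vonMangoldt (((f i).eval (n : ℤ)).toNat)) ≤ B * x

/-- item stmt-Parity-19029 · support · rank 9 · open · by planner
sources: HardyLittlewood1914, Korevaar2004, MontgomeryVaughan2007
[support] Hardy–Littlewood (1914) / Karamata Tauberian theorem for Dirichlet series with
non-negative coefficients, logarithmic conclusion: b ≥ 0, Σ b(n) n^(−σ) summable for σ > 1 and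
(σ−1)Σ b(n)n^(−σ) → C as σ → 1⁺ imply Σ_(n≤x) b(n)/n ~ C log x (MontgomeryVaughan2007 Thm 5.11 with
β = 1). [difficulty: L] -/
@[route_item "route-Parity-HurwitzTauber"]
def KaramataLog : Prop :=
  ∀ (b : ℕ → ℝ), (∀ n, 0 ≤ b n) → ∀ C : ℝ, (∀ σ : ℝ, 1 < σ → Summable (fun n : ℕ => b n * (n : ℝ) ^ (-σ))) → Filter.Tendsto (fun σ : ℝ => (σ - 1) * ∑' n : ℕ, b n * (n : ℝ) ^ (-σ)) (nhdsWithin 1 (Set.Ioi 1)) (nhds C) → Filter.Tendsto (fun x : ℕ => (∑ n ∈ Finset.Icc 1 x, b n / n) / Real.log x) Filter.atTop (nhds C)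

/-- item stmt-Parity-19030 · support · rank 9 · open · by planner
sources: Schmidt1925, Korevaar2004, Hall1996SetsOfMultiples
[support] Schmidt-type Tauberian theorem for the logarithmic mean: b ≥ 0 with Σ_(n≤x) b(n) ≤ Bx,
logarithmic mean value C, and one-sided slow decrease of x⁻¹Σ_(n≤x) b(n) on multiplicative scales x
→ x^(1+δ) imply the mean value C (Cesàro mean in u = log x plus slow decrease on [u,(1+δ)u];
elementary). [difficulty: M] -/
@[route_item "route-Parity-HurwitzTauber"]
def SchmidtScales : Prop :=
  ∀ (b : ℕ → ℝ), (∀ n, 0 ≤ b n) → (∃ B : ℝ, ∀ x : ℕ, ∑ n ∈ Finset.Icc 1 x, b n ≤ B * x) → ∀ C : ℝ, Filter.Tendsto (fun x : ℕ => (∑ n ∈ Finset.Icc 1 x, b n / n) / Real.log x) Filter.atTop (nhds C) → (∀ ε : ℝ, 0 < ε → ∃ δ : ℝ, 0 < δ ∧ ∃ N₀ : ℕ, ∀ N N' : ℕ, N₀ ≤ N → N ≤ N' → (N' : ℝ) ≤ (N : ℝ) ^ (1 + δ) → (∑ n ∈ Finset.Icc 1 N, b n) / N - ε ≤ (∑ n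 ∈ Finset.Icc 1 N', b n) / N') → Filter.Tendsto (fun x : ℕ => (∑ n ∈ Finset.Icc 1 x, b n) / x) Filter.atTop (nhds C)

/-- item stmt-Parity-19031 · assembly · rank 1 · open · by planner
sources: Korevaar2004, HardyLittlewood1914, Schmidt1925
[assembly] LogMobiusTail → RootHurwitzLaw → SlowDecrease → FrameToBH → BatemanHorn. -/
@[route_item "route-Parity-HurwitzTauber"]
def Assembly : Prop :=
  LogMobiusTail → RootHurwitzLaw → SlowDecrease → FrameToBH → _root_.BatemanHorn

/-! D-0027 §2.1 — DECIDING THEOREM (planner-authored via `route open/edit --closes-file`; by planner-plan-lens3-Parity-rescuer-g2-0 2026-08-17T03:14:19Z):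
its hypotheses are this route's items and its conclusion the sub-problem Statement (glue_lint), and it elaborates with this file. -/

@[closes "route-Parity-HurwitzTauber"] theorem closes (hTail : LogMobiusTail) (hRoot : RootHurwitzLaw) (hSlow : SlowDecrease)
    (hFrame : FrameToBH) : _root_.BatemanHorn :=
  fun k f hf => hFrame k f hf (hTail k f hf) (hRoot k f hf) (hSlow k f hf)

end Summit.Parity.BatemanHorn.Theses.HurwitzTauber
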